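import Summits.CriticalPhenomena.PercolationContinuityZ3.Theorems.PercNearOneGluingNoHeavyLowerTailKnQuestion8CoefficientwiseCoreClassKernelMixBridgeAbs
import Summits.CriticalPhenomena.PercolationContinuityZ3.Theorems.PercNearOneGluingNoHeavyLowerTailKnQuestion8CoefficientwiseCoreClassSeriesMain
import HarnessLib

/-!
# KB-MIX along a BRIDGE — the graph form: THEOREM A (KB-MIX-FULL across a bridge) and THEOREM B (the one-sided form crosses a bridge to ANY graph)

Support file (`--supports stmt-CriticalPhenomena-4575`, closed), prover `prim-cplus-coupling` (gen 36).  No definitions, no notations, no named facts,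
no sorries; standard axioms.  Memo `prim-cplus-coupling/A5-COUPLING-gen36.md` §2.  Companions: `…CoreClassKernelMixBridgeCells` / `…BridgeAbs` (the abstract
bookkeeping), `…CoreClassKernelMixBridgeMain` (sources of the one-sided form; CW-PA over `a′–M–b′` for EVERY middle `M`).

Setting.  Finite multigraph `ends : ι → Sym2 V`; vertex-disjoint edge sets `E₁, E₂`; a BRIDGE `e ∉ E₁ ∪ E₂`, `ends e = s(c₁, c₂)`, `c₁` on no edge of
`E₂`, `c₂` on no edge of `E₁`; terminals `a` on the `E₁` side (`a = c₁` allowed) and `b` on the `E₂` side (`b = c₂` allowed); `H = E₁ ∪ {e} ∪ E₂`;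
`C_v(ω) = openCluster (ends '' ω) v`.  Forms (explicit inequalities, all levels monotone, `0 ≤ hᵃ, hᵇ ≤ h`, `0 ≤ kᵃ, kᵇ ≤ k`):
KB-MIX-FULL(E; a, b) = `Σ_ω h(C_a ω ∪ C_b ω)k(…) + Σ_{b ∉ C_a ω, b ∉ C_a(E∖ω)} (hᵃ(C_a ω) − hᵇ(C_b(E∖ω)))(kᵃ(C_a ω) − kᵇ(C_b(E∖ω))) ≥ 0`;
ONE-SIDED(E; x, y) = `Σ_ω h(C_x ω ∪ C_y ω)k(…) + Σ_{y ∉ C_x ω} (hˣ(C_x ω) − hʸ(C_y(E∖ω)))(kˣ(C_x ω) − kʸ(C_y(E∖ω))) ≥ 0` (the wall enlarged by the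
cell where `x` is a contact point, `x ∈ C_y(E∖ω)`).
* `Coefficientwise.openCluster_bridge_side` — clusters of a side root across the bridge: `C_v(ω₁ ∪ e ∪ ω₂) = C_v ω₁ ∪ [c₁ ∈ C_v ω₁](c₁ ∪ C_{c₂} ω₂)`,
  `C_v(ω₁ ∪ ω₂) = C_v ω₁` (from the cut-vertex identities of `…CoreClassSeriesClusters` and the leaf identities).
* `Coefficientwise.coreClass_kernelMixFull_bridge` — **THEOREM A**: ONE-SIDED(E₁; c₁, a) ∧ ONE-SIDED(E₂; c₂, b) (each glued by constant sets) ⟹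
  KB-MIX-FULL(H; a, b).
* `Coefficientwise.coreClass_oneSided_bridge` — **THEOREM B**: ONE-SIDED(E₁; c₁, a) alone ⟹ ONE-SIDED(H; b, a), for ANY `E₂` and any `b` on its side
  (the `E₂` side is paid by the free full anti-sum `coreClass_fullAnti`).  So the one-sided form propagates along arbitrary bridged chains, and with
  THEOREM A closes to KB-MIX-FULL when the last block is one-sided too: the KB-MIX calculus (LEAF, DECOR, SERIES(OSR), PAR) is now ITERABLE along bridges.
Consequences (memo §2.3): KB-MIX-FULL — hence CW-PA on prim-lf-2's core class — for every bridged chain whose two end blocks have proper domination maps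
(cycles, bundles, pocket-free blocks, single vertices) with ARBITRARY blocks in between; this covers all DOM failures known (n = 8 leaf–Θ–leaf, n = 12
leaf–core–leaf, and the n = 13 cycle chains C3–C6–C4 refuting DOM-SUBCUBIC⁺ found this generation).
[cite: KozmaNitzan2024, Questions 8–9 (§5.5 p. 36) (context: the Question-8 pocket covariance programme)]
-/

namespace Summit.CriticalPhenomena.PercolationContinuityZ3.Theorems

open Finset Literature.Probability.Percolation

namespace Coefficientwise

variable {ι V : Type*}

/-! ### Clusters across a bridge edge -/

/-- The side `E₁` and the pendant-extended side `insert e E₂` (`e = c₁c₂` the bridge, `c₂` on no edge of `E₁`, the sides vertex-disjoint) meet only at `c₁`.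
[cite: KozmaNitzan2024, §5.5 (context only; folklore)] -/
theorem bridge_sep_insert [DecidableEq ι] (ends : ι → Sym2 V) (E₁ E₂ : Finset ι) (e : ι) (c₁ c₂ : V) (hends : ends e = s(c₁, c₂))
    (hsep : ∀ i ∈ E₁, ∀ j ∈ E₂, ∀ u, u ∈ ends i → u ∈ ends j → False) (hc₂ : ∀ i ∈ E₁, c₂ ∉ ends i) :
    ∀ i ∈ E₁, ∀ j ∈ insert e E₂, ∀ u, u ∈ ends i → u ∈ ends j → u = c₁ := by
  intro i hi j hj u hui huj
  rcases Finset.mem_insert.mp hj with hj | hj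
  · subst hj
    rw [hends, Sym2.mem_iff] at huj
    rcases huj with h | h
    · exact h
    · exact absurd hui (h ▸ hc₂ i hi)
  · exact (hsep i hi j hj u hui huj).elim

/-- **Cluster of a side root across a bridge.**  With `e = c₁c₂` a bridge between the vertex-disjoint sides `E₁ ⊇ ω₁`, `E₂ ⊇ ω₂`, and a root `v` of the
`E₁` side (`v ≠ c₂` on no edge of `E₂`; `v = c₁` allowed):  `C_v(ω₁ ∪ insert e ω₂) = C_v(ω₁) ∪ {y | c₁ ∈ C_v(ω₁) ∧ y ∈ insert c₁ (C_{c₂}(ω₂))}`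
(`e` red) and `C_v(ω₁ ∪ ω₂) = C_v(ω₁)` (`e` blue). [cite: KozmaNitzan2024, §5.5 (context only; folklore)] -/
theorem openCluster_bridge_side [DecidableEq ι] (ends : ι → Sym2 V) (E₁ E₂ ω₁ ω₂ : Finset ι) (e : ι) (c₁ c₂ v : V) (hends : ends e = s(c₁, c₂))
    (hsep : ∀ i ∈ E₁, ∀ j ∈ E₂, ∀ u, u ∈ ends i → u ∈ ends j → False) (hc₁ : ∀ j ∈ E₂, c₁ ∉ ends j) (hc₂ : ∀ i ∈ E₁, c₂ ∉ ends i)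
    (hω₁ : ω₁ ⊆ E₁) (hω₂ : ω₂ ⊆ E₂) (hv2 : v ≠ c₂) (hvE : ∀ j ∈ E₂, v ∉ ends j) :
    openCluster (ends '' (↑(ω₁ ∪ insert e ω₂) : Set ι)) v =
        openCluster (ends '' (↑ω₁ : Set ι)) v ∪ {y | c₁ ∈ openCluster (ends '' (↑ω₁ : Set ι)) v ∧ y ∈ insert c₁ (openCluster (ends '' (↑ω₂ : Set ι)) c₂)}
      ∧ openCluster (ends '' (↑(ω₁ ∪ ω₂) : Set ι)) v = openCluster (ends '' (↑ω₁ : Set ι)) v := by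
  set C : Finset ι → V → Set V := fun ω v => openCluster (ends '' (↑ω : Set ι)) v with hC
  change C (ω₁ ∪ insert e ω₂) v = C ω₁ v ∪ {y | c₁ ∈ C ω₁ v ∧ y ∈ insert c₁ (C ω₂ c₂)} ∧ C (ω₁ ∪ ω₂) v = C ω₁ v
  have hsepD := bridge_sep_insert ends E₁ E₂ e c₁ c₂ hends hsep hc₂
  have hc₁ω₂ : ∀ j ∈ ω₂, c₁ ∉ ends j := fun j hj => hc₁ j (hω₂ hj)
  have hroot : C (insert e ω₂) c₁ = insert c₁ (C ω₂ c₂) := openCluster_leaf_root_insert ends ω₂ hends hc₁ω₂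
  have hsingle : C ω₂ c₁ = {c₁} := openCluster_eq_singleton_of_no_edge_at ends ω₂ hc₁ω₂
  -- the cut-vertex form (cut vertex c₁ between E₁ and insert e E₂) for the root v, both colours of e
  have hcut : ∀ δ, δ ⊆ insert e E₂ → C (ω₁ ∪ δ) v = C ω₁ v ∪ {y | c₁ ∈ C ω₁ v ∧ y ∈ C δ c₁} := by
    intro δ hδ
    by_cases hvc : v = c₁
    · subst hvc
      rw [show C (ω₁ ∪ δ) v = C ω₁ v ∪ C δ v from openCluster_cut_root ends E₁ (insert e E₂) ω₁ δ v hsepD hω₁ hδ]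
      ext y; simp only [Set.mem_union, Set.mem_setOf_eq]
      constructor
      · rintro (hy | hy); exact Or.inl hy; exact Or.inr ⟨mem_openCluster_self _ _, hy⟩
      · rintro (hy | ⟨_, hy⟩); exact Or.inl hy; exact Or.inr hy
    · have hvD : ∀ j ∈ insert e E₂, v ∉ ends j := by
        intro j hj
        rcases Finset.mem_insert.mp hj with hj | hj
        · subst hj; rw [hends, Sym2.mem_iff, not_or]; exact ⟨hvc, hv2⟩
        · exact hvE j hj
      exact openCluster_cut_side ends E₁ (insert e E₂) ω₁ δ c₁ v hsepD hω₁ hδ hvD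
  refine ⟨?_, ?_⟩
  · rw [hcut (insert e ω₂) (Finset.insert_subset_insert e hω₂), hroot]
  · rw [hcut ω₂ (le_trans hω₂ (Finset.subset_insert e E₂)), hsingle]
    ext y; simp only [Set.mem_union, Set.mem_setOf_eq, Set.mem_singleton_iff]
    constructor
    · rintro (hy | ⟨hc, hy⟩); exact hy; exact hy ▸ hc
    · intro hy; exact Or.inl hy

/-- The far terminal `b` (on no edge of `E₁`, `b ≠ a`) is never in an `E₁`-cluster of `a`. [cite: KozmaNitzan2024, §5.5 (context only; folklore)] -/
theorem not_mem_openCluster_side (ends : ι → Sym2 V) (E₁ ω₁ : Finset ι) (a b : V) (hω₁ : ω₁ ⊆ E₁) (hbE : ∀ i ∈ E₁, b ∉ ends i) (hab : a ≠ b) :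
    b ∉ openCluster (ends '' (↑ω₁ : Set ι)) a := by
  intro hb
  obtain ⟨i, hi, hbi⟩ := exists_edge_of_mem_openCluster ends hb (Ne.symm hab)
  exact hbE i (hω₁ hi) hbi

open Classical in
/-- **THEOREM A (KB-MIX-FULL across a bridge).**  Finite multigraph `ends`; vertex-disjoint edge sets `E₁, E₂` (no common vertex: `hsep`); a bridge edge
`e ∉ E₁ ∪ E₂` with `ends e = s(c₁, c₂)`, `c₁` on no edge of `E₂`, `c₂` on no edge of `E₁`; terminals `a` (on no edge of `E₂`, `a ≠ c₂`; `a = c₁`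
allowed) and `b` (on no edge of `E₁`, `b ≠ c₁`; `b = c₂` allowed), `a ≠ b`; monotone `h, k` and monotone levels `0 ≤ hᵃ, hᵇ ≤ h`, `0 ≤ kᵃ, kᵇ ≤ k`.
HYPOTHESES (one-sided forms of the two sides, glued by constant sets): for every `B`,
`0 ≤ Σ_{ω₁ ⊆ E₁} h(B ∪ C_{c₁}ω₁ ∪ C_a ω₁)k(…) + Σ_{ω₁ : a ∉ C_{c₁} ω₁} (hᵇ(B ∪ C_{c₁} ω₁) − hᵃ(C_a(E₁∖ω₁)))(kᵇ(B ∪ C_{c₁} ω₁) − kᵃ(C_a(E₁∖ω₁)))`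
(ONE-SIDED(E₁; c₁, a), contact at `c₁` allowed), and for every `A`,
`0 ≤ Σ_{ω₂ ⊆ E₂} h(A ∪ C_{c₂}ω₂ ∪ C_b ω₂)k(…) + Σ_{ω₂ : b ∉ C_{c₂} ω₂} (hᵃ(A ∪ C_{c₂} ω₂) − hᵇ(C_b(E₂∖ω₂)))(kᵃ(A ∪ C_{c₂} ω₂) − kᵇ(C_b(E₂∖ω₂)))`
(ONE-SIDED(E₂; c₂, b)).  CONCLUSION: KB-MIX-FULL of `H = E₁ ∪ {e} ∪ E₂` at `(a, b)`:
`0 ≤ Σ_{ω ⊆ H} h(C_a ω ∪ C_b ω)k(C_a ω ∪ C_b ω) + Σ_{ω ⊆ H : b ∉ C_a ω, b ∉ C_a(H∖ω)} (hᵃ(C_a ω) − hᵇ(C_b(H∖ω)))(kᵃ(C_a ω) − kᵇ(C_b(H∖ω)))`.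
[cite: KozmaNitzan2024, Questions 8–9 (§5.5 p. 36) (context)] -/
theorem coreClass_kernelMixFull_bridge (ends : ι → Sym2 V) (E₁ E₂ : Finset ι) (e : ι) (c₁ c₂ a b : V)
    (hdisj : Disjoint E₁ E₂) (he₁ : e ∉ E₁) (he₂ : e ∉ E₂) (hends : ends e = s(c₁, c₂))
    (hsep : ∀ i ∈ E₁, ∀ j ∈ E₂, ∀ u, u ∈ ends i → u ∈ ends j → False)
    (hc₁ : ∀ j ∈ E₂, c₁ ∉ ends j) (hc₂ : ∀ i ∈ E₁, c₂ ∉ ends i)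
    (haE : ∀ j ∈ E₂, a ∉ ends j) (hac : a ≠ c₂) (hbE : ∀ i ∈ E₁, b ∉ ends i) (hbc : b ≠ c₁) (hab : a ≠ b)
    (h k ha hb ka kb : Set V → ℝ) (hh : Monotone h) (hk : Monotone k)
    (ha0 : ∀ X, 0 ≤ ha X) (hah : ∀ X, ha X ≤ h X) (hb0 : ∀ X, 0 ≤ hb X) (hbh : ∀ X, hb X ≤ h X)
    (ka0 : ∀ X, 0 ≤ ka X) (kak : ∀ X, ka X ≤ k X) (kb0 : ∀ X, 0 ≤ kb X) (kbk : ∀ X, kb X ≤ k X)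
    (hOS₁ : ∀ B : Set V, 0 ≤ (∑ ω₁ ∈ E₁.powerset,
        h (B ∪ (openCluster (ends '' (↑ω₁ : Set ι)) c₁ ∪ openCluster (ends '' (↑ω₁ : Set ι)) a)) *
          k (B ∪ (openCluster (ends '' (↑ω₁ : Set ι)) c₁ ∪ openCluster (ends '' (↑ω₁ : Set ι)) a)))
      + ∑ ω₁ ∈ E₁.powerset.filter (fun ω₁ : Finset ι => a ∉ openCluster (ends '' (↑ω₁ : Set ι)) c₁),
        (hb (B ∪ openCluster (ends '' (↑ω₁ : Set ι)) c₁) - ha (openCluster (ends '' (↑(E₁ \ ω₁) : Set ι)) a)) *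
          (kb (B ∪ openCluster (ends '' (↑ω₁ : Set ι)) c₁) - ka (openCluster (ends '' (↑(E₁ \ ω₁) : Set ι)) a)))
    (hOS₂ : ∀ A : Set V, 0 ≤ (∑ ω₂ ∈ E₂.powerset,
        h (A ∪ (openCluster (ends '' (↑ω₂ : Set ι)) c₂ ∪ openCluster (ends '' (↑ω₂ : Set ι)) b)) *
          k (A ∪ (openCluster (ends '' (↑ω₂ : Set ι)) c₂ ∪ openCluster (ends '' (↑ω₂ : Set ι)) b)))
      + ∑ ω₂ ∈ E₂.powerset.filter (fun ω₂ : Finset ι => b ∉ openCluster (ends '' (↑ω₂ : Set ι)) c₂),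
        (ha (A ∪ openCluster (ends '' (↑ω₂ : Set ι)) c₂) - hb (openCluster (ends '' (↑(E₂ \ ω₂) : Set ι)) b)) *
          (ka (A ∪ openCluster (ends '' (↑ω₂ : Set ι)) c₂) - kb (openCluster (ends '' (↑(E₂ \ ω₂) : Set ι)) b))) :
    0 ≤ (∑ ω ∈ (E₁ ∪ insert e E₂).powerset,
        h (openCluster (ends '' (↑ω : Set ι)) a ∪ openCluster (ends '' (↑ω : Set ι)) b) *
          k (openCluster (ends '' (↑ω : Set ι)) a ∪ openCluster (ends '' (↑ω : Set ι)) b))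
      + ∑ ω ∈ (E₁ ∪ insert e E₂).powerset.filter (fun ω : Finset ι => b ∉ openCluster (ends '' (↑ω : Set ι)) a ∧
            b ∉ openCluster (ends '' (↑((E₁ ∪ insert e E₂) \ ω) : Set ι)) a),
        (ha (openCluster (ends '' (↑ω : Set ι)) a) - hb (openCluster (ends '' (↑((E₁ ∪ insert e E₂) \ ω) : Set ι)) b)) *
          (ka (openCluster (ends '' (↑ω : Set ι)) a) - kb (openCluster (ends '' (↑((E₁ ∪ insert e E₂) \ ω) : Set ι)) b)) := by
  set C : Finset ι → V → Set V := fun ω v => openCluster (ends '' (↑ω : Set ι)) v with hC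
  set H : Finset ι := E₁ ∪ insert e E₂ with hH
  change ∀ B : Set V, 0 ≤ (∑ ω₁ ∈ E₁.powerset, h (B ∪ (C ω₁ c₁ ∪ C ω₁ a)) * k (B ∪ (C ω₁ c₁ ∪ C ω₁ a)))
      + ∑ ω₁ ∈ E₁.powerset.filter (fun ω₁ => a ∉ C ω₁ c₁), (hb (B ∪ C ω₁ c₁) - ha (C (E₁ \ ω₁) a)) * (kb (B ∪ C ω₁ c₁) - ka (C (E₁ \ ω₁) a)) at hOS₁
  change ∀ A : Set V, 0 ≤ (∑ ω₂ ∈ E₂.powerset, h (A ∪ (C ω₂ c₂ ∪ C ω₂ b)) * k (A ∪ (C ω₂ c₂ ∪ C ω₂ b)))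
      + ∑ ω₂ ∈ E₂.powerset.filter (fun ω₂ => b ∉ C ω₂ c₂), (ha (A ∪ C ω₂ c₂) - hb (C (E₂ \ ω₂) b)) * (ka (A ∪ C ω₂ c₂) - kb (C (E₂ \ ω₂) b)) at hOS₂
  change 0 ≤ (∑ ω ∈ H.powerset, h (C ω a ∪ C ω b) * k (C ω a ∪ C ω b))
      + ∑ ω ∈ H.powerset.filter (fun ω => b ∉ C ω a ∧ b ∉ C (H \ ω) a), (ha (C ω a) - hb (C (H \ ω) b)) * (ka (C ω a) - kb (C (H \ ω) b))
  -- side facts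
  have hdisjD : Disjoint E₁ (insert e E₂) := Finset.disjoint_insert_right.mpr ⟨he₁, hdisj⟩
  have hsep' : ∀ i ∈ E₂, ∀ j ∈ E₁, ∀ u, u ∈ ends i → u ∈ ends j → False := fun i hi j hj u hui huj => hsep j hj i hi u huj hui
  have hends' : ends e = s(c₂, c₁) := by rw [hends, Sym2.eq_swap]
  have sideA : ∀ ω₁ ω₂, ω₁ ⊆ E₁ → ω₂ ⊆ E₂ →
      C (ω₁ ∪ insert e ω₂) a = C ω₁ a ∪ {y | c₁ ∈ C ω₁ a ∧ y ∈ insert c₁ (C ω₂ c₂)} ∧ C (ω₁ ∪ ω₂) a = C ω₁ a :=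
    fun ω₁ ω₂ hω₁ hω₂ => openCluster_bridge_side ends E₁ E₂ ω₁ ω₂ e c₁ c₂ a hends hsep hc₁ hc₂ hω₁ hω₂ hac haE
  have sideB : ∀ ω₁ ω₂, ω₁ ⊆ E₁ → ω₂ ⊆ E₂ →
      C (ω₁ ∪ insert e ω₂) b = C ω₂ b ∪ {y | c₂ ∈ C ω₂ b ∧ y ∈ insert c₂ (C ω₁ c₁)} ∧ C (ω₁ ∪ ω₂) b = C ω₂ b := by
    intro ω₁ ω₂ hω₁ hω₂
    have hsw := openCluster_bridge_side ends E₂ E₁ ω₂ ω₁ e c₂ c₁ b hends' hsep' hc₂ hc₁ hω₂ hω₁ hbc hbE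
    have e1 : ω₂ ∪ insert e ω₁ = ω₁ ∪ insert e ω₂ := by
      rw [Finset.union_insert, Finset.union_insert, Finset.union_comm]
    have e2 : ω₂ ∪ ω₁ = ω₁ ∪ ω₂ := Finset.union_comm _ _
    rw [e1, e2] at hsw
    exact hsw
  have hsdR : ∀ ω₁ ω₂, ω₁ ⊆ E₁ → ω₂ ⊆ E₂ → H \ (ω₁ ∪ insert e ω₂) = (E₁ \ ω₁) ∪ (E₂ \ ω₂) := by
    intro ω₁ ω₂ hω₁ hω₂
    rw [hH, sdiff_union_sdiff E₁ (insert e E₂) ω₁ (insert e ω₂) hdisjD hω₁ (Finset.insert_subset_insert e hω₂)]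
    congr 1
    ext i; simp only [Finset.mem_sdiff, Finset.mem_insert, not_or]
    constructor
    · rintro ⟨h1, h2, h3⟩; rcases h1 with h1 | h1; exact absurd h1 h2; exact ⟨h1, h3⟩
    · rintro ⟨h1, h2⟩; exact ⟨Or.inr h1, fun h3 => he₂ (h3 ▸ h1), h2⟩
  have hsdB : ∀ ω₁ ω₂, ω₁ ⊆ E₁ → ω₂ ⊆ E₂ → H \ (ω₁ ∪ ω₂) = (E₁ \ ω₁) ∪ insert e (E₂ \ ω₂) := by
    intro ω₁ ω₂ hω₁ hω₂
    rw [hH, sdiff_union_sdiff E₁ (insert e E₂) ω₁ ω₂ hdisjD hω₁ (le_trans hω₂ (Finset.subset_insert e E₂))]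
    congr 1
    ext i; simp only [Finset.mem_sdiff, Finset.mem_insert]
    constructor
    · rintro ⟨h1, h2⟩; rcases h1 with h1 | h1; exact Or.inl h1; exact Or.inr ⟨h1, h2⟩
    · rintro (h1 | ⟨h1, h2⟩); exact ⟨Or.inl h1, fun h3 => he₂ (h1 ▸ hω₂ h3)⟩; exact ⟨Or.inr h1, h2⟩
  have hbP : ∀ ω₁, ω₁ ⊆ E₁ → b ∉ C ω₁ a := fun ω₁ hω₁ => not_mem_openCluster_side ends E₁ ω₁ a b hω₁ hbE hab
  -- the abstract theorem
  have habs := bridge_kernelMixFull_abs E₁ E₂ c₁ c₂ a b (fun ω₁ => C ω₁ a) (fun ω₁ => C ω₁ c₁) (fun ω₂ => C ω₂ c₂) (fun ω₂ => C ω₂ b)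
    (fun ω₁ _ hc1 y hy => SimpleGraph.Reachable.trans hc1 hy) (fun ω₁ _ => mem_openCluster_comm ends ω₁ c₁ a)
    h k ha hb ka kb hh hk ha0 hah hb0 hbh ka0 kak kb0 kbk hOS₁ hOS₂
  -- rewrite the sums over H as double sums and match termwise
  rw [Finset.sum_filter, hH, sum_powerset_union_disjoint hdisjD, sum_powerset_union_disjoint hdisjD, ← Finset.sum_add_distrib]
  rw [← hH]
  refine le_trans habs (le_of_eq (Finset.sum_congr rfl fun ω₁ hω₁ => ?_))
  have hω₁ := Finset.mem_powerset.mp hω₁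
  rw [Finset.sum_powerset_insert he₂, Finset.sum_powerset_insert he₂, ← Finset.sum_add_distrib, ← Finset.sum_add_distrib, ← Finset.sum_add_distrib]
  refine Finset.sum_congr rfl fun ω₂ hω₂ => ?_
  have hω₂ := Finset.mem_powerset.mp hω₂
  obtain ⟨aR, aB⟩ := sideA ω₁ ω₂ hω₁ hω₂
  obtain ⟨bR, bB⟩ := sideB ω₁ ω₂ hω₁ hω₂
  obtain ⟨aR', aB'⟩ := sideA (E₁ \ ω₁) (E₂ \ ω₂) Finset.sdiff_subset Finset.sdiff_subset
  obtain ⟨bR', bB'⟩ := sideB (E₁ \ ω₁) (E₂ \ ω₂) Finset.sdiff_subset Finset.sdiff_subset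
  rw [hsdR ω₁ ω₂ hω₁ hω₂, hsdB ω₁ ω₂ hω₁ hω₂, aR, aB, bR, bB, aB', bB', aR', bR']
  -- wall conditions
  have hb1 := hbP ω₁ hω₁
  have hb2 := hbP (E₁ \ ω₁) Finset.sdiff_subset
  have wR : (b ∉ C ω₁ a ∪ {y | c₁ ∈ C ω₁ a ∧ y ∈ insert c₁ (C ω₂ c₂)} ∧ b ∉ C (E₁ \ ω₁) a) ↔ ¬ (c₁ ∈ C ω₁ a ∧ b ∈ C ω₂ c₂) := by
    simp only [Set.mem_union, Set.mem_setOf_eq, Set.mem_insert_iff, not_or]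
    constructor
    · rintro ⟨⟨_, h2⟩, _⟩ ⟨h3, h4⟩; exact h2 ⟨h3, Or.inr h4⟩
    · intro h1; refine ⟨⟨hb1, fun h2 => h1 ⟨h2.1, h2.2.resolve_left hbc⟩⟩, hb2⟩
  have wB : (b ∉ C ω₁ a ∧ b ∉ C (E₁ \ ω₁) a ∪ {y | c₁ ∈ C (E₁ \ ω₁) a ∧ y ∈ insert c₁ (C (E₂ \ ω₂) c₂)}) ↔
      ¬ (c₁ ∈ C (E₁ \ ω₁) a ∧ c₂ ∈ C (E₂ \ ω₂) b) := by
    simp only [Set.mem_union, Set.mem_setOf_eq, Set.mem_insert_iff, not_or]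
    rw [← mem_openCluster_comm ends (E₂ \ ω₂) c₂ b]
    constructor
    · rintro ⟨_, _, h2⟩ ⟨h3, h4⟩; exact h2 ⟨h3, Or.inr h4⟩
    · intro h1; exact ⟨hb1, hb2, fun h2 => h1 ⟨h2.1, h2.2.resolve_left hbc⟩⟩
  by_cases cR : ¬ (c₁ ∈ C ω₁ a ∧ b ∈ C ω₂ c₂) <;> by_cases cB : ¬ (c₁ ∈ C (E₁ \ ω₁) a ∧ c₂ ∈ C (E₂ \ ω₂) b)
  · rw [if_pos (wR.mpr cR), if_pos cR, if_pos (wB.mpr cB), if_pos cB]; ring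
  · rw [if_pos (wR.mpr cR), if_pos cR, if_neg (fun hx => cB (wB.mp hx)), if_neg cB]; ring
  · rw [if_neg (fun hx => cR (wR.mp hx)), if_neg cR, if_pos (wB.mpr cB), if_pos cB]; ring
  · rw [if_neg (fun hx => cR (wR.mp hx)), if_neg cR, if_neg (fun hx => cB (wB.mp hx)), if_neg cB]; ring


open Classical in
/-- **THEOREM B (the one-sided form crosses a bridge to ANY graph).**  Same bridge setting as `coreClass_kernelMixFull_bridge`.  HYPOTHESIS: only the
one-sided form of the `E₁` side, ONE-SIDED(E₁; c₁, a) glued by every constant set `B` (as displayed there) — NOTHING is assumed about `E₂`.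
CONCLUSION: ONE-SIDED(H; b, a) for `H = E₁ ∪ {e} ∪ E₂` (contact at `b` allowed):
`0 ≤ Σ_{ω ⊆ H} h(C_b ω ∪ C_a ω)k(C_b ω ∪ C_a ω) + Σ_{ω ⊆ H : a ∉ C_b ω} (hᵇ(C_b ω) − hᵃ(C_a(H∖ω)))(kᵇ(C_b ω) − kᵃ(C_a(H∖ω)))`.
The `E₂` side is paid by the free full anti-sum (`coreClass_fullAnti`).  Iterating: the one-sided form propagates along any chain of bridges, whatever the
blocks in between. [cite: KozmaNitzan2024, Questions 8–9 (§5.5 p. 36) (context)] -/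
theorem coreClass_oneSided_bridge (ends : ι → Sym2 V) (E₁ E₂ : Finset ι) (e : ι) (c₁ c₂ a b : V)
    (hdisj : Disjoint E₁ E₂) (he₁ : e ∉ E₁) (he₂ : e ∉ E₂) (hends : ends e = s(c₁, c₂))
    (hsep : ∀ i ∈ E₁, ∀ j ∈ E₂, ∀ u, u ∈ ends i → u ∈ ends j → False)
    (hc₁ : ∀ j ∈ E₂, c₁ ∉ ends j) (hc₂ : ∀ i ∈ E₁, c₂ ∉ ends i)
    (haE : ∀ j ∈ E₂, a ∉ ends j) (hac : a ≠ c₂) (hbE : ∀ i ∈ E₁, b ∉ ends i) (hbc : b ≠ c₁) (hab : a ≠ b)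
    (h k ha hb ka kb : Set V → ℝ) (hh : Monotone h) (hk : Monotone k)
    (mha : Monotone ha) (mhb : Monotone hb) (mka : Monotone ka) (mkb : Monotone kb)
    (ha0 : ∀ X, 0 ≤ ha X) (hah : ∀ X, ha X ≤ h X) (hb0 : ∀ X, 0 ≤ hb X) (hbh : ∀ X, hb X ≤ h X)
    (ka0 : ∀ X, 0 ≤ ka X) (kak : ∀ X, ka X ≤ k X) (kb0 : ∀ X, 0 ≤ kb X) (kbk : ∀ X, kb X ≤ k X)
    (hOS₁ : ∀ B : Set V, 0 ≤ (∑ ω₁ ∈ E₁.powerset,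
        h (B ∪ (openCluster (ends '' (↑ω₁ : Set ι)) c₁ ∪ openCluster (ends '' (↑ω₁ : Set ι)) a)) *
          k (B ∪ (openCluster (ends '' (↑ω₁ : Set ι)) c₁ ∪ openCluster (ends '' (↑ω₁ : Set ι)) a)))
      + ∑ ω₁ ∈ E₁.powerset.filter (fun ω₁ : Finset ι => a ∉ openCluster (ends '' (↑ω₁ : Set ι)) c₁),
        (hb (B ∪ openCluster (ends '' (↑ω₁ : Set ι)) c₁) - ha (openCluster (ends '' (↑(E₁ \ ω₁) : Set ι)) a)) *
          (kb (B ∪ openCluster (ends '' (↑ω₁ : Set ι)) c₁) - ka (openCluster (ends '' (↑(E₁ \ ω₁) : Set ι)) a))) :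
    0 ≤ (∑ ω ∈ (E₁ ∪ insert e E₂).powerset,
        h (openCluster (ends '' (↑ω : Set ι)) b ∪ openCluster (ends '' (↑ω : Set ι)) a) *
          k (openCluster (ends '' (↑ω : Set ι)) b ∪ openCluster (ends '' (↑ω : Set ι)) a))
      + ∑ ω ∈ (E₁ ∪ insert e E₂).powerset.filter (fun ω : Finset ι => a ∉ openCluster (ends '' (↑ω : Set ι)) b),
        (hb (openCluster (ends '' (↑ω : Set ι)) b) - ha (openCluster (ends '' (↑((E₁ ∪ insert e E₂) \ ω) : Set ι)) a)) *
          (kb (openCluster (ends '' (↑ω : Set ι)) b) - ka (openCluster (ends '' (↑((E₁ ∪ insert e E₂) \ ω) : Set ι)) a)) := by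
  set C : Finset ι → V → Set V := fun ω v => openCluster (ends '' (↑ω : Set ι)) v with hC
  set H : Finset ι := E₁ ∪ insert e E₂ with hH
  change ∀ B : Set V, 0 ≤ (∑ ω₁ ∈ E₁.powerset, h (B ∪ (C ω₁ c₁ ∪ C ω₁ a)) * k (B ∪ (C ω₁ c₁ ∪ C ω₁ a)))
      + ∑ ω₁ ∈ E₁.powerset.filter (fun ω₁ => a ∉ C ω₁ c₁), (hb (B ∪ C ω₁ c₁) - ha (C (E₁ \ ω₁) a)) * (kb (B ∪ C ω₁ c₁) - ka (C (E₁ \ ω₁) a)) at hOS₁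
  change 0 ≤ (∑ ω ∈ H.powerset, h (C ω b ∪ C ω a) * k (C ω b ∪ C ω a))
      + ∑ ω ∈ H.powerset.filter (fun ω => a ∉ C ω b), (hb (C ω b) - ha (C (H \ ω) a)) * (kb (C ω b) - ka (C (H \ ω) a))
  -- side facts (as in THEOREM A)
  have hdisjD : Disjoint E₁ (insert e E₂) := Finset.disjoint_insert_right.mpr ⟨he₁, hdisj⟩
  have hsep' : ∀ i ∈ E₂, ∀ j ∈ E₁, ∀ u, u ∈ ends i → u ∈ ends j → False := fun i hi j hj u hui huj => hsep j hj i hi u huj hui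
  have hends' : ends e = s(c₂, c₁) := by rw [hends, Sym2.eq_swap]
  have sideA : ∀ ω₁ ω₂, ω₁ ⊆ E₁ → ω₂ ⊆ E₂ →
      C (ω₁ ∪ insert e ω₂) a = C ω₁ a ∪ {y | c₁ ∈ C ω₁ a ∧ y ∈ insert c₁ (C ω₂ c₂)} ∧ C (ω₁ ∪ ω₂) a = C ω₁ a :=
    fun ω₁ ω₂ hω₁ hω₂ => openCluster_bridge_side ends E₁ E₂ ω₁ ω₂ e c₁ c₂ a hends hsep hc₁ hc₂ hω₁ hω₂ hac haE
  have sideB : ∀ ω₁ ω₂, ω₁ ⊆ E₁ → ω₂ ⊆ E₂ →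
      C (ω₁ ∪ insert e ω₂) b = C ω₂ b ∪ {y | c₂ ∈ C ω₂ b ∧ y ∈ insert c₂ (C ω₁ c₁)} ∧ C (ω₁ ∪ ω₂) b = C ω₂ b := by
    intro ω₁ ω₂ hω₁ hω₂
    have hsw := openCluster_bridge_side ends E₂ E₁ ω₂ ω₁ e c₂ c₁ b hends' hsep' hc₂ hc₁ hω₂ hω₁ hbc hbE
    have e1 : ω₂ ∪ insert e ω₁ = ω₁ ∪ insert e ω₂ := by
      rw [Finset.union_insert, Finset.union_insert, Finset.union_comm]
    have e2 : ω₂ ∪ ω₁ = ω₁ ∪ ω₂ := Finset.union_comm _ _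
    rw [e1, e2] at hsw
    exact hsw
  have hsdR : ∀ ω₁ ω₂, ω₁ ⊆ E₁ → ω₂ ⊆ E₂ → H \ (ω₁ ∪ insert e ω₂) = (E₁ \ ω₁) ∪ (E₂ \ ω₂) := by
    intro ω₁ ω₂ hω₁ hω₂
    rw [hH, sdiff_union_sdiff E₁ (insert e E₂) ω₁ (insert e ω₂) hdisjD hω₁ (Finset.insert_subset_insert e hω₂)]
    congr 1
    ext i; simp only [Finset.mem_sdiff, Finset.mem_insert, not_or]
    constructor
    · rintro ⟨h1, h2, h3⟩; rcases h1 with h1 | h1; exact absurd h1 h2; exact ⟨h1, h3⟩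
    · rintro ⟨h1, h2⟩; exact ⟨Or.inr h1, fun h3 => he₂ (h3 ▸ h1), h2⟩
  have hsdB : ∀ ω₁ ω₂, ω₁ ⊆ E₁ → ω₂ ⊆ E₂ → H \ (ω₁ ∪ ω₂) = (E₁ \ ω₁) ∪ insert e (E₂ \ ω₂) := by
    intro ω₁ ω₂ hω₁ hω₂
    rw [hH, sdiff_union_sdiff E₁ (insert e E₂) ω₁ ω₂ hdisjD hω₁ (le_trans hω₂ (Finset.subset_insert e E₂))]
    congr 1
    ext i; simp only [Finset.mem_sdiff, Finset.mem_insert]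
    constructor
    · rintro ⟨h1, h2⟩; rcases h1 with h1 | h1; exact Or.inl h1; exact Or.inr ⟨h1, h2⟩
    · rintro (h1 | ⟨h1, h2⟩); exact ⟨Or.inl h1, fun h3 => he₂ (h1 ▸ hω₂ h3)⟩; exact ⟨Or.inr h1, h2⟩
  have haQ : ∀ ω₂, ω₂ ⊆ E₂ → a ∉ C ω₂ b := fun ω₂ hω₂ => not_mem_openCluster_side ends E₂ ω₂ b a hω₂ haE (Ne.symm hab)
  -- the free full anti-sum of E₂, glued by A
  have hFA₂ : ∀ A : Set V, 0 ≤ (∑ ω₂ ∈ E₂.powerset, h (A ∪ (C ω₂ c₂ ∪ C ω₂ b)) * k (A ∪ (C ω₂ c₂ ∪ C ω₂ b)))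
      + ∑ ω₂ ∈ E₂.powerset, (ha (A ∪ C ω₂ c₂) - hb (C (E₂ \ ω₂) b)) * (ka (A ∪ C ω₂ c₂) - kb (C (E₂ \ ω₂) b)) := by
    intro A
    have hA : ∀ X Y : Set V, X ⊆ Y → A ∪ X ⊆ A ∪ Y := fun X Y hXY => Set.union_subset_union_right A hXY
    exact coreClass_fullAnti ends E₂ c₂ b (fun X => h (A ∪ X)) (fun X => k (A ∪ X)) (fun X => ha (A ∪ X)) hb (fun X => ka (A ∪ X)) kb
      (fun X Y hXY => hh (hA X Y hXY)) (fun X Y hXY => hk (hA X Y hXY)) (fun X Y hXY => mha (hA X Y hXY)) mhb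
      (fun X Y hXY => mka (hA X Y hXY)) mkb (fun X => ha0 _) (fun X => hah _) (fun X => hb0 _)
      (fun X => le_trans (hbh X) (hh Set.subset_union_right)) (fun X => ka0 _) (fun X => kak _) (fun X => kb0 _)
      (fun X => le_trans (kbk X) (hk Set.subset_union_right))
  have habs := bridge_oneSided_abs E₁ E₂ c₁ c₂ a (fun ω₁ => C ω₁ a) (fun ω₁ => C ω₁ c₁) (fun ω₂ => C ω₂ c₂) (fun ω₂ => C ω₂ b)
    (fun ω₁ _ hc1 y hy => SimpleGraph.Reachable.trans hc1 hy) (fun ω₁ _ => mem_openCluster_comm ends ω₁ c₁ a)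
    h k ha hb ka kb hh hk ha0 hah hb0 hbh ka0 kak kb0 kbk hOS₁ hFA₂
  -- supply: C_b ∪ C_a = C_a ∪ C_b; anti-sum: reindex by ω ↦ H ∖ ω into the (C_a ω, C_b(H∖ω)) form
  have hsupp : ∑ ω ∈ H.powerset, h (C ω b ∪ C ω a) * k (C ω b ∪ C ω a) = ∑ ω ∈ H.powerset, h (C ω a ∪ C ω b) * k (C ω a ∪ C ω b) :=
    Finset.sum_congr rfl fun ω _ => by rw [Set.union_comm]
  have hanti : ∑ ω ∈ H.powerset.filter (fun ω => a ∉ C ω b), (hb (C ω b) - ha (C (H \ ω) a)) * (kb (C ω b) - ka (C (H \ ω) a))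
      = ∑ ω ∈ H.powerset, (if a ∉ C (H \ ω) b then (ha (C ω a) - hb (C (H \ ω) b)) * (ka (C ω a) - kb (C (H \ ω) b)) else 0) := by
    rw [Finset.sum_filter, ← sum_powerset_sdiff H (fun ω => if a ∉ C ω b then (hb (C ω b) - ha (C (H \ ω) a)) * (kb (C ω b) - ka (C (H \ ω) a)) else 0)]
    refine Finset.sum_congr rfl fun ω hω => ?_
    rw [Finset.sdiff_sdiff_eq_self (Finset.mem_powerset.mp hω)]
    by_cases hq : a ∉ C (H \ ω) b
    · rw [if_pos hq, if_pos hq]; ring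
    · rw [if_neg hq, if_neg hq]
  rw [hsupp, hanti, hH, sum_powerset_union_disjoint hdisjD, sum_powerset_union_disjoint hdisjD, ← Finset.sum_add_distrib]
  rw [← hH]
  refine le_trans habs (le_of_eq (Finset.sum_congr rfl fun ω₁ hω₁ => ?_))
  have hω₁ := Finset.mem_powerset.mp hω₁
  rw [Finset.sum_powerset_insert he₂, Finset.sum_powerset_insert he₂, ← Finset.sum_add_distrib, ← Finset.sum_add_distrib, ← Finset.sum_add_distrib]
  refine Finset.sum_congr rfl fun ω₂ hω₂ => ?_
  have hω₂ := Finset.mem_powerset.mp hω₂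
  obtain ⟨aR, aB⟩ := sideA ω₁ ω₂ hω₁ hω₂
  obtain ⟨bR, bB⟩ := sideB ω₁ ω₂ hω₁ hω₂
  obtain ⟨bR', bB'⟩ := sideB (E₁ \ ω₁) (E₂ \ ω₂) Finset.sdiff_subset Finset.sdiff_subset
  rw [hsdR ω₁ ω₂ hω₁ hω₂, hsdB ω₁ ω₂ hω₁ hω₂, aR, aB, bR, bB, bB', bR']
  have ha1 := haQ (E₂ \ ω₂) Finset.sdiff_subset
  have wB : (a ∉ C (E₂ \ ω₂) b ∪ {y | c₂ ∈ C (E₂ \ ω₂) b ∧ y ∈ insert c₂ (C (E₁ \ ω₁) c₁)}) ↔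
      ¬ (c₁ ∈ C (E₁ \ ω₁) a ∧ c₂ ∈ C (E₂ \ ω₂) b) := by
    simp only [Set.mem_union, Set.mem_setOf_eq, Set.mem_insert_iff, not_or]
    rw [mem_openCluster_comm ends (E₁ \ ω₁) c₁ a]
    constructor
    · rintro ⟨_, h2⟩ ⟨h3, h4⟩; exact h2 ⟨h4, Or.inr h3⟩
    · intro h1; exact ⟨ha1, fun h2 => h1 ⟨h2.2.resolve_left hac, h2.1⟩⟩
  rw [if_pos ha1]
  by_cases cB : ¬ (c₁ ∈ C (E₁ \ ω₁) a ∧ c₂ ∈ C (E₂ \ ω₂) b)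
  · rw [if_pos (wB.mpr cB), if_pos cB]; ring
  · rw [if_neg (fun hx => cB (wB.mp hx)), if_neg cB]; ring

end Coefficientwise

end Summit.CriticalPhenomena.PercolationContinuityZ3.Theorems
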